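import Mathlib
import HarnessLib
import HarnessLib.Audit
import Summits.NavierStokesRegularity.Statement
import Literature.Analysis.FluidPDE.ClassicalSolution
import Literature.Analysis.FluidPDE.LerayHopf
import Literature.Analysis.FluidPDE.SuitableWeak
import Literature.Analysis.FluidPDE.VectorCalculus
import Summits.NavierStokesRegularity.NavierStokesRegularity.Theorems.TypeICertificateLadderNoBlowupToClay
import HarnessLib.Audit.Status.Attr

/-!
Route: AffineBernoulli

# Route AffineBernoulli — Leray meets Arnold — at Kelvin-neutral γ = 1/2 the inviscid Type-II
skeleton is affine-integrable; classify it empty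

X = ClosedWindowSkeleton ∧ EulerLerayLiouville ("it suffices to show"; card
leray-euler-affine-bernoulli, spine). The EULER–LERAY
PROFILE CLASS 𝓔½ is the set of C² divergence-free W on ℝ³ with |W| ≲ ⟨y⟩⁻¹, |∇W| ≲ ⟨y⟩⁻² solving the
self-similar Euler system at
exactly Leray's exponent γ = 1/2, ½W + DW·(½(y−c) + W) + ∇P = 0 (Pomeau's "Euler–Leray equations";
length √(T−t), velocity
(T−t)^{-1/2}, the one exponent Kelvin's theorem leaves neutral). EulerLerayLiouville (Euler side,
card K2): 𝓔½ = {0}.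
ClosedWindowSkeleton (NS side, card K3): a finite-energy classical solution from Clay data with
finite maximal lifespan and NON-Type-I
rate has an inviscid zoom converging to an exact self-similar Euler profile with exponent in the
CLOSED Kelvin window 2/5 ≤ γ ≤ 1/2 —
either a window profile, γ < 1/2 (verbatim the conclusion of VortexLineClock's TypeIIWindowCore,
stmt-11272), or a nontrivial
W ∈ 𝓔½ (sup-normalised velocity zoom, local Reynolds number → ∞, C¹_loc convergence). With the
shared EmptyEulerWindow (stmt-11273)
X gives NoTypeII (stmt-0056) by pure logic, and with NoTypeIBlowup (stmt-1217) and NoBlowupToClay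
(stmt-0055) it gives Clay (A).
Lean: `ClosedWindowSkeleton ∧ EulerLerayLiouville`

## Assembly
Pure logic (glue.lean `closes`, lean check rc 0, 0 sorry, axioms
propext/Classical.choice/Quot.sound): apply NoBlowupToClay; a
Leray–Hopf classical solution on [0,T) from a rapidly decaying datum with no smooth extension past T
is maximal; if Type I, NoTypeIBlowup
extends it — contradiction; if not, ClosedWindowSkeleton gives a window profile — denied by
EmptyEulerWindow — or a W ∈ 𝓔½ with
‖W(0)‖ ≥ 1/2 — denied by EulerLerayLiouville (W 0 = 0). AxisymEulerLerayLiouville and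
AlignedStratumTrivial are special cases of
EulerLerayLiouville (Sketch.lean `axisym_of_liouville`, `aligned_of_liouville`); the three
provable-now supports feed its proof and do
not enter `closes`.

Rationale: WHY THIS LINE. Kelvin's circulation theorem pins every Euler-driven (local Reynolds number → ∞)
self-similar collapse to γ = 1/2 (Pomeau2017;
GinibreLeberrePomeau2019 §4; ConstantinIgnatovaVicol2026Putative Rem. 3.6, Thms 3.8/4.4/4.6:
outgoing or swirling stagnation points
force γ ≥ 1/2), NecasRuzickaSverak1996/Tsai1998 kill only the VISCOUS γ = 1/2 profile, and
ChaeShvydkoy2013 (Thms 3.2, 4.1) kill every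
inviscid profile strictly inside the decay class (W ∈ L³ or Ω ∈ L^p, p < 3/2) while Xinyu He
(doi:10.1007/s00021-005-0205-3) builds
γ = 1/2 profiles with exactly the ⟨y⟩⁻¹/⟨y⟩⁻² tail on EXTERIOR domains: 𝓔½ is the one inviscid
skeleton a log-dressed ("nearly
self-similar", Hou2022PotentiallySingularNS, Hou2026) Navier–Stokes singularity can still shadow,
its far field is free data, and its
emptiness must come from the INTERIOR. The mechanism (card): at γ = 1/2 — and only there — CIV's
Bernoulli identity
(1−2γ)V + Ω×V + ∇ℋ = 0 (arXiv:2602.17570 p.10) degenerates into an integrable structure in Arnold's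
sense: with V = ½(y−c) + W
(div V = 3/2), Ω = curl W, ℋ = ½|V|² + P − |y−c|²/8 one has (B) Ω × V = −∇ℋ and (C) [V,Ω] = −(3/2)Ω,
so ℋ is a bounded first
integral of both V and Ω with far-field datum h_∞(θ) = ½θ̂·σ(θ), regular Bernoulli surfaces carry a
locally free action of the
non-unimodular affine group Aff⁺(ℝ) (no tori: planes/cylinders swept to infinity), vorticity deserts
surround every source of V, and
the aligned stratum Ω ∥ V is kinematically consistent exactly because div V = 3/2 equals the weight
in (C). Imported: Arnold–Khesin
topological hydrodynamics (ArnoldKhesin1998 Ch. II structure theorem, here with an affine instead of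
abelian pair), hyperbolic
dynamics of the similarity flow (Poincaré–Hopf, stable/unstable manifolds), blow-up rescaling at the
Euler scaling (Seregin2024).
What no prior route does: VortexLineClock works strictly inside the open window γ < 1/2 (its NS crux
stmt-11272 demands γ < 1/2; at
γ = 1/2 its flux-capacity recurrence degenerates because the vorticity flux through large spheres is
O(1), and CIV's outgoing
exclusion is borderline) — this route closes the window at its Kelvin-neutral endpoint with a
different invariant (a first integral,
not a clock); TypeIIInviscidRelaxation/MarginalTypeI use no profile structure; the negatives index
could not be fetched at filing (gate overloaded) — the card's filing found it empty.

RANKED CRUXES. #0 NoTypeII (target) — shared target stmt-NavierStokesRegularity-0056 — a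
finite-energy classical solution from a rapidly decaying datum with finite maximal lifespan T blows
up at most at the Type-I rate ‖u(t)‖∞ ≤ C(T−t)^{-1/2} (IsTypeIBlowup u T); here it follows from
ClosedWindowSkeleton ∧ EmptyEulerWindow ∧ EulerLerayLiouville by pure logic (Sketch.lean
`target_of_cruxes`). (why it might fail: a finite-energy Type-II singularity (= ¬Clay A): Tao's
averaged blow-up is Type II (arXiv:1402.0290 p.8 fn.), Hou's axisymmetric scenario
(arXiv:2107.06509) would be Type II if singular.) [Tao2016AveragedNS, Hou2022PotentiallySingularNS,
KochNadirashviliSereginSverak2009, Seregin2024]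
#2 EulerLerayLiouville (crux) — EULER–LERAY LIOUVILLE (card K2): if W ∈ C²(ℝ³;ℝ³) is divergence
free, P ∈ C¹, ½W + DW(y)(½(y−c) + W(y)) + ∇P(y) = 0 for all y, and |W(y)| ≤ C⟨y⟩⁻¹, ‖DW(y)‖ ≤
C⟨y⟩⁻², then W ≡ 0. Intended proof: Arnold-type classification of the affine-integrable structure
(B)+(C) — vorticity deserts on basins of sources (VorticityDesert), Poincaré–Hopf (index sum +1
forces a 2-stable saddle or worse once sources are vorticity-free), Bernoulli surfaces pinned to
critical values along unstable manifolds, far-field matching ℋ = h_∞∘θ_∞, and the aligned stratum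
(AlignedStratumTrivial). [difficulty: open-problem] (why it might fail: the decay class is exactly
critical (ChaeShvydkoy2013 need W∈L³ / Ω∈L^p, p<3/2), He builds such profiles on exterior domains,
the far field σ(θ) is free data: a smooth completion across a saddle-type stagnation set may exist
(it would be Hou's skeleton).) [ChaeShvydkoy2013, doi:10.1007/s00021-005-0205-3,
ConstantinIgnatovaVicol2026Putative, Pomeau2017, arXiv:1901.09426, ArnoldKhesin1998,
Hou2022PotentiallySingularNS]
#3 ClosedWindowSkeleton (crux) — CLOSED-WINDOW SKELETON (card K3, NS side): for ν, T > 0 and a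
maximal classical solution (u,p) on [0,T) that is Leray–Hopf from a rapidly decaying datum and NOT
Type I, EITHER the conclusion of VortexLineClock's TypeIIWindowCore holds verbatim (an exact window
profile (γ,U,Ω), 2/5 ≤ γ < 1/2, with CIV matched decay, reached by a vorticity-normalised zoom at
diverging local Reynolds number in C¹_loc), OR there are a centre c, a profile W ∈ 𝓔½ (clauses of
EulerLerayLiouville) with ‖W(0)‖ ≥ 1/2, times t_k ↑ T, centres x_k, sup bounds N_k ≥ ‖u(t_k)‖_∞ with
N_k → ∞, lengths L_k → 0 with local Reynolds number N_k L_k/ν → ∞ and isometries Q_k such that y ↦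
N_k⁻¹Q_k⁻¹u(t_k, x_k + L_k Q_k y) → W in C¹ on every ball. Heuristic: Type II ⇔ R(t) = (T−t)‖u‖²_∞/ν
unbounded; a zoom at velocity scale N = g(T−t)^{-1/2} and Euler length L = N(T−t) sees viscosity
ν/g² → 0 and, modulo slowly varying factors, the γ = 1/2 similarity system; power-law excess g ~
(T−t)^{-δ} gives the window equation with γ = 1/2 − δ instead (finite energy: γ ≥ 2/5, CIV Thm 2.1).
Weaker than stmt-11272 (Sketch.lean `closedWindow_of_windowCore`). [difficulty: open-problem] (why
it might fail: Type II need not be asymptotically self-similar: log-periodic (DSS) skeletons —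
Pomeau–Le Berre build τ-periodic Euler–Leray solutions formally (arXiv:1901.09426 §3) —, multiscale
cascades, or mere C⁰ compactness of Seregin's Euler-scaling limits all escape both disjuncts.)
[Seregin2024, arXiv:1901.09426, Hou2022PotentiallySingularNS, Hou2026,
ConstantinIgnatovaVicol2026Putative, KochNadirashviliSereginSverak2009, Chae2007]
#4 AxisymEulerLerayLiouville (crux) — AXISYMMETRIC EULER–LERAY LIOUVILLE, swirl allowed (card K2,
first case; centre on the axis, translated to 0): an axisymmetric W ∈ 𝓔½ (IsAxisymmetric W, clauses
of EulerLerayLiouville with c = 0) vanishes identically. Beyond Pomeau–Le Berre (§2.3: the swirl G =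
ρW_φ = `swirl W` is a first integral of V, so G ≡ 0 IF G → 0 at infinity — support
AxisymDecayingSwirlLiouville) the content is the BOUNDED swirl datum g_∞(θ) = lim ρW_φ along rays: G
= g_∞∘θ_∞ on the basin of infinity, the meridional similarity flow has its zeros on the axis or on
circles, and Z = Ω_φ/ρ obeys V·∇Z + (3/2)Z = ∂_z(G²)/ρ⁴; show g_∞ ≢ 0 is incompatible with
smoothness at the stagnation set. Decides whether Hou's axisymmetric scenario can have a steady γ =
1/2 skeleton. [difficulty: L] (why it might fail: Hou's axisymmetric interior blow-up
(arXiv:2107.06509 §3.4) is nearly self-similar with ‖u‖∞ ~ (T−t)^{-1/2}: its limiting profile, if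
steady, is a nontrivial axisymmetric member of 𝓔½ with swirl datum g_∞ ≢ 0, refuting the crux.)
[arXiv:1901.09426, Hou2022PotentiallySingularNS, Hou2026, ConstantinIgnatovaVicol2026Putative,
ChaeShvydkoy2013]
#5 AlignedStratumTrivial (crux) — ALIGNED (BELTRAMI-LIKE) STRATUM IS TRIVIAL (card K1, the
degenerate case of the Bernoulli-surface structure theorem): if W ∈ 𝓔½ (clauses of
EulerLerayLiouville) has Ω × V ≡ 0, i.e. curl W ∥ ½(y−c) + W everywhere (equivalently ℋ locally
constant — no Bernoulli foliation), then W ≡ 0. At γ = 1/2 this ansatz is kinematically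
self-consistent (Ω = λV with V·∇λ = −(3/2)λ solves div Ω = 0 precisely because div V = 3/2), so it
is a genuine stratum, not a formality; λ is transported with weight −3/2, forcing backward
V-trajectories of aligned points to reach Zeros(V) at exponential rate ≥ 3/2. [difficulty: M] (why
it might fail: a 'similarity-Beltrami' field curl W = λ(½(y−c)+W) with |W| ~ 1/|y| hanging off a
saddle with an unstable eigenvalue > 3/2 is not excluded by any known argument; Beltrami fields are
exactly where Arnold's structure theorem is silent.) [ArnoldKhesin1998,
ConstantinIgnatovaVicol2026Putative, Chae2007CMPEuler]
#9 AffineBernoulliIdentities (support) — card P1 (provable now, two pages of calculus): for C²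
divergence-free W and C¹ P solving the γ = 1/2 profile equation with centre c (no decay needed),
with V = ½(y−c) + W, Ω = curl W, ℋ(z) = ½‖½(z−c) + W(z)‖² + P(z) − ⅛‖z−c‖²: (B) ∇ℋ = −Ω × V (so V·∇ℋ
= Ω·∇ℋ = 0) and (C) DΩ·V − DW·Ω = −Ω, i.e. [V,Ω] = −(3/2)Ω (= CIV (3.x) at γ = 1/2; the vorticity
form used verbatim by VortexLineClock). [difficulty: provable-now]
[ConstantinIgnatovaVicol2026Putative, arXiv:2602.17570, MajdaBertozzi2002]
#9 VorticityDesert (support) — SOURCE LEMMA (card P1, local form; provable now): if V, Ω are C¹ on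
ℝ³, V(y₀) = 0, the symmetric part of DV(y₀) is pinched a‖v‖² ≤ ⟨DV(y₀)v, v⟩ ≤ b‖v‖² with 0 < a and b
< 3/2, and DΩ·V − DV·Ω = −(3/2)Ω everywhere, then Ω vanishes on a neighbourhood of y₀. Proof: f =
‖Ω‖² satisfies V·∇f = 2⟨DV Ω,Ω⟩ − 3f ≤ −(3 − 2b − o(1)) f near y₀ while backward V-trajectories from
a small ball stay in it and converge to y₀; f bounded there forces f = 0. (CIV Prop. 3.9 is the γ <
1/2 + c* analogue at outgoing points.) [difficulty: provable-now]
[ConstantinIgnatovaVicol2026Putative, arXiv:2602.17570]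
#9 AxisymDecayingSwirlLiouville (support) — POMEAU–LE BERRE CASE made a theorem (provable now, needs
ODE-flow infrastructure): an axisymmetric W ∈ 𝓔½ (c = 0) whose swirl G = ρW_φ (`swirl W`) tends to 0
at infinity vanishes identically. Proof: G is a first integral of the complete field V = ½y + W
(arXiv:1901.09426 eq. after (2.3)); the bounded invariant set Inv(V) is Lebesgue-null since the flow
multiplies volume by e^{3σ/2}, so G ≡ 0 on the dense basin of infinity; with no swirl Z = Ω_φ/ρ
satisfies V·∇Z = −(3/2)Z, backward trajectories are bounded (V·y ≥ ½|y|² − C), hence Z ≡ 0, Ω ≡ 0,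
and a curl- and divergence-free field decaying at infinity is 0. [difficulty: L] [arXiv:1901.09426,
Pomeau2017, ChaeShvydkoy2013]
#9 EmptyEulerWindow (support) — shared stmt-NavierStokesRegularity-11273 (crux #3 of route
VortexLineClock, staffed there): THE EULER WINDOW IS EMPTY — no exact self-similar Euler profile
with 2/5 ≤ γ < 1/2, Lipschitz normalised vorticity and CIV matched decay. Kills the first disjunct
of ClosedWindowSkeleton. [difficulty: open-problem] [ConstantinIgnatovaVicol2026Putative,
arXiv:2602.17570, arXiv:2511.16254, ChaeShvydkoy2013]
#9 NoTypeIBlowup (support) — shared stmt-NavierStokesRegularity-1217 (the Type-I half, owned by the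
Liouville programme: TypeILiouville, ThreadingFlux, ClockStretchingLaw …): a Leray–Hopf classical
solution from a rapidly decaying datum that blows up at most at the Type-I rate extends smoothly
past T. [difficulty: open-problem] [KochNadirashviliSereginSverak2009, AlbrittonBarker2019,
SereginSverak2009]
#9 NoBlowupToClay (support) — shared stmt-NavierStokesRegularity-0055: given no blow-up for
Leray–Hopf classical solutions from rapidly decaying data, build the Clay (A) solution (local
classical theory, continuation, weak–strong uniqueness, energy inequality,
Literature.Analysis.FluidPDE.isNavierStokesSolution_and_smooth_iff). [difficulty: provable-now]
[Leray1934, KochNadirashviliSereginSverak2009, Fefferman2000]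

TWO-LAYER PLAN. Foreseen glued splits (nothing filed now; k ≤ 3, depth 1): EulerLerayLiouville ⇐
AlignedStratumTrivial → BernoulliSurfaceStructure
(regular level sets of ℋ are properly embedded Aff⁺(ℝ)-homogeneous planes/cylinders swept to
infinity, every V-trajectory has α-limit in
the compact null set Inv(V) and an asymptotic direction θ_∞ constant on Bernoulli surfaces, ℋ =
h_∞∘θ_∞) → SaddleBookkeeping (vorticity
deserts at sources + Poincaré–Hopf + unstable manifolds pinned to critical values of ℋ exhaust the
far-field datum) → EulerLerayLiouville;
AxisymEulerLerayLiouville ⇐ AxisymDecayingSwirlLiouville → (bounded swirl datum: G = g_∞∘θ_∞ versus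
the on-axis stagnation set, CIV
Thm 4.6-type bookkeeping at γ = 1/2) → AxisymEulerLerayLiouville; ClosedWindowSkeleton ⇐ (inviscid
velocity-core extraction at
R(t_k) → ∞ with C¹_loc compactness) → (rigidity: a limit that is steady in log-time solves the γ =
1/2 or a window system with matched
decay) → ClosedWindowSkeleton. Analytic-profile versions (CIV-style real-analyticity at stagnation
points) may be filed as support first.

KILL CRITERIA. A nontrivial W ∈ 𝓔½ exhibited (constructed à la He/Elgindi from far-field data
through a non-outgoing stagnation set, or certified
numerically: Newton on the steady γ = 1/2 similarity system seeded with Hou's rescaled interior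
profile, PINN searches of
doi:10.1103/PhysRevLett.130.244002 run at γ = 1/2) refutes EulerLerayLiouville: close
`refuted:EulerLerayLiouville` and hand W to the
negative side (card marginal-reynolds-creep-kappa: W + modulation law ⇒ log-dressed blow-up). An
axisymmetric one refutes
AxisymEulerLerayLiouville with it (same close). AlignedStratumTrivial refuted alone (a
similarity-Beltrami field) ⇒ the Arnold picture
has an unfoliated stratum: pivot EulerLerayLiouville to 'non-aligned profiles' only if
ClosedWindowSkeleton can be sharpened to exclude
aligned limits, else close. ClosedWindowSkeleton refuted by a rigorous DSS/log-periodic Type-II core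
⇒ pivot (not close): add the
s-periodic disjunct and a transport-only Liouville crux (at γ = 1/2 the vorticity 2-form and, in AX,
the swirl stay exactly
Lie-transported by ∂_s + V; only the Bernoulli integral is lost). AffineBernoulliIdentities or
VorticityDesert refuted ⇒ the mechanism is
miscomputed — retire at once. A finite-energy Type-II blow-up from Schwartz data refutes the target
(¬A). NoTypeII proved elsewhere
moots the NS side; EmptyEulerWindow refuted (a window profile exists) does not kill this route's
Euler side but breaks `closes` — then
re-glue through VortexLineClock's negative pivot or restrict ClosedWindowSkeleton.

NOT DECOMPOSED YET. The Bernoulli-surface structure theorem itself (completeness of V and Ω on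
regular level sets, regular-value issues, stratification of
the critical set {Ω × V = 0} ⊇ Zeros(V) ∪ Zeros(Ω)) — layer 2 under EulerLerayLiouville, typed once
a definition `EulerLerayProfile` /
`selfSimilarBernoulli` lands; the Poincaré–Hopf bookkeeping for V = ½(y−c) + W (index sum +1; AX:
off-axis zeros are circles of index
0); far-field asymptotics W = σ(θ)/|y| + O(|y|⁻³) (the similarity operator is invertible on
faster-decaying corrections, so σ is free,
div(σ/r) = 0); how ClosedWindowSkeleton is proved (choice of zoom, compactness, steadiness of the
limit); the DSS variant; analyticity
inputs (CIV Prop 3.9-type infinite-order vanishing ⇒ deserts for analytic profiles). Definition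
requests are convenience only.

CHEAPEST FALSIFIER. (1) The two identities and the source lemma are three short computations — a
refuter re-derives (B), (C) (done twice: card audit
TRIAGE-22 and this planner: (1−γ)U + DU·(γy+U) = (1−2γ)V − ∇(γ(1−γ)|y|²/2) + ∇½|V|² + Ω×V; curl
gives [V,Ω] = −(1+γ)Ω) and checks the
aligned-stratum consistency div(λV) = 0 ⇔ weight 3/2. (2) Literature kill, DONE: ChaeShvydkoy2013
Thms 3.2/4.1/4.2 stop exactly at the
⟨y⟩⁻¹/⟨y⟩⁻² tail (He's exterior examples are cited there as the reason), Chae2007 (Math. Ann.) needs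
the VISCOUS Leray scaling, CIV needs
outgoing or γ < 1/2 — none decides 𝓔½. (3) Next cheapest (kit-able, not run: no profile data in the
store): take Hou's rescaled
axisymmetric interior profile (arXiv:2107.06509 §3.4) as seed for Newton on the steady γ = 1/2
axisymmetric similarity system on a
large ball with σ(θ)/|y| boundary data; convergence to a smooth nontrivial profile refutes
AxisymEulerLerayLiouville numerically and
flips the card to its negative branch.

NUMBERS. Exponents: length (T−t)^γ, velocity (T−t)^{γ−1}; Kelvin-neutral ⇔ γ = 1/2 (circulation
weight 1−2γ, CIV Rem 3.6; Pomeau2017: α = β =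
1/2); finite energy ⇒ γ ≥ 2/5 (CIV Thm 2.1, in tree as
Literature.Analysis.FluidPDE.CIV2026_collapseExponent_ge_two_fifths); viscous
γ = 1/2 profile dead (NRŠ 1996 L³, Tsai 1998 L^q/local energy). Decay class: |W| ~ ⟨y⟩⁻¹ ∈
L^{3,∞}∖L³, |Ω| ~ ⟨y⟩⁻² ∈ L^{3/2,∞}∖L^{3/2}
— ChaeShvydkoy2013 Thm 3.2 needs W ∈ L^p, p ≥ 3 with α = 1 ≤ 3/p (so p = 3), Thm 4.1 needs Ω ∈ L^p,
p < 3/2: both borderline. Weights: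
div V = 3γ = 3/2, [V,Ω] = −(1+γ)Ω = −(3/2)Ω, det DΦ_σ = e^{3σ/2}; source eigenvalues have real parts
in (0, 3/2). Far field:
ℋ → ½θ̂·σ(θ), correction O(|y|⁻³). Hou 2022 §3.4: ‖u‖∞ ~ (T−t)^{-1/2}, ‖ω‖∞ ~ |log(T−t)|/(T−t).
Items at open: 12 (1 target, 4 cruxes,
1 assembly, 6 support; 4 shared: stmt-0056, stmt-11273, stmt-1217, stmt-0055).

DEFINITION REQUESTS. None load-bearing (the 𝓔½ clauses are inlined identically in
EulerLerayLiouville, ClosedWindowSkeleton, AxisymEulerLerayLiouville,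
AlignedStratumTrivial and the supports, so the glue is pure logic). Worth factoring later:
`IsEulerLerayProfile c W P` (the five clauses)
and `selfSimilarBernoulli c W P` in Literature/Analysis/FluidPDE next to PutativeSelfSimilarEuler;
`IsAffinePair V Ω κ` ([V,Ω] = −κΩ) in
Literature/Geometry. Bib additions wanted when the gate is reachable: Pomeau–Le Berre 2019
(arXiv:1901.09426), He 2007
(doi:10.1007/s00021-005-0205-3; paywalled, acquisition acq-03835), He 2004 (JMFM 6, 389–404).

Novelty: Searches (2026-08-15, this planner, on top of the card's audited record TRIAGE-22): `lit read
arxiv:1901.09426` pp.4,8,9 (PL §2.3 read in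
full: decaying-swirl heuristic only, cites [YP]; §3 τ-periodic solutions by solvability); `lit read
arxiv:1201.6009` = ChaeShvydkoy2013
pp.2–4,7–8,10–11 (Thms 3.2, 4.1, 4.2; He's exterior α = 1 profiles with |v| ~ |y|⁻¹ flagged as the
critical case); `lit read
arxiv:2602.17570 --grep Bernoulli` (p.10 §3.4.3 identity, Rem 3.6); `lit read arxiv:1904.02387` =
GinibreLeberrePomeau2019 §4 (at α = β
circulation gives NO constraint; open question only for α ≠ β; no Bernoulli/vorticity structure);
`lit search --source arxiv
"self-similar Euler Leray equations Pomeau"` (4: GLP2019, Lam arXiv:1812.00957, PL2019, PLL2018);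
`lit search --source crossref "Xinyu He
finite-time singularities 3d Euler"` (He 2006/2007 JMFM, He 2000 AML, He 2005 MPCPS); `lit search
--source zbmath "self-similar
singularity incompressible Euler nonexistence profile"` (2: Chae2007, HouLi2007); `lit frontier
NavierStokesRegularity --since 2024` (30
rows; only Hou2026 FoCM relevant, no γ = 1/2 structure theory); `lit galaxy search "Euler-Leray
equations" --star all` (0),
`"self-similar Euler" --star pdf` (6, compressible/other); local `lit search`/searchd and OpenAlex
unavailable (rc 75 / HTTP 429, logged).
Nearest prior art found: Pomeau2017 + arXiv:1901.09426 §2.3 (the object 𝓔½, the similarity flow w =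
u + R/2 with div 3/2, swirl as
first integral, AX decaying-swirl heuristic  [refs: 10.1007/s00021-005-0205-3, 1901.09426, 1201.6009, 2602.17570, 1904.02387, 1812.00957, arxiv:1901.09426, arxiv:1201.6009, arxiv:2602.17570, arxiv:1904.02387, doi:10.1007/s00021-005-0205-3, ChaeShvydkoy2013, GinibreLeberrePomeau2019, Chae2007, HouLi2007, Hou2026, Pomeau2017, ArnoldKhesin1998]

Barriers (technique_class: integrable-structure arnold-topology euler-liouville): - technique_class: integrable-structure arnold-topology euler-liouville
- Literature.Barriers.NavierStokesRegularity.LeraySelfSimilarBlowupExclusion: not evaded but USED —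
NRŠ/Tsai/Chae2007 empty the VISCOUS γ = 1/2 profile and the viscous asymptotically-self-similar
scenario; the route works one level below, on the INVISCID skeleton reached at local Reynolds number
→ ∞ (ClosedWindowSkeleton's zoom has N_k L_k/ν → ∞, not the Leray normalisation), which that
barrier's tools do not touch.
- Literature.Barriers.NavierStokesRegularity.TaoAveragedBlowup: evaded by the Euler-side items —
exact Lie transport of the vorticity 2-form, the Bernoulli first integral and the topology of its
level sets are structure of B(u,u) = P(ω × u) that an averaged bilinear form does not possess; NOT
evaded by ClosedWindowSkeleton as a bare classification claim — the bet is that it is attacked by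
vorticity-transport compactness/rigidity, not by energy + harmonic analysis.
- Literature.Barriers.NavierStokesRegularity.TruncatedDyadicBlowup: same remark — the target
NoTypeII is a rate statement false in dyadic/averaged models; it is claimed only through an
equation-specific structural alternative plus two Liouville theorems.
- Literature.Barriers.NavierStokesRegularity.EnergySupercriticality: evaded in kind (first
integrals, index theory and hyperbolic dynamics of the similarity flow are dimensionless structure,
not coercive norms; the only energy input is CIV's γ ≥ 2/5) but conceded in scope: everything

Novelty grade: new-combination — Refuter grade (g44-6; lit searchd down this session — grade rests on the planner's cited sources as described in the route and on my re-derivations). Stripped mechanism: 'at γ = 1/2 the self-similar Euler system has a Bernoulli first integral ℋ for BOTH V = ½(y−c)+W and Ω, with the affine commutatio (refuter refuter-refute-pool-g44-6, 2026-08-15T20:02:17Z; prior: ConstantinIgnatovaVicol arXiv:2602.17570 (Bernoulli identity, all γ), PomeauLeBerre arXiv:1901.09426 §2.3, §3, ChaeShvydkoy2013 Thms 3.2/4.1, ArnoldKhesin1998 Ch. II structure theorem, He 2007 doi:10.1007/s00021-005-0205-3 (exterior γ=1/2 profiles))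

History (route lifecycle, newest last):
- 2026-08-15T20:08:49Z · rev 1: restated AxisymEulerLerayLiouville (stmt-NavierStokesRegularity-13662), AxisymDecayingSwirlLiouville (stmt-NavierStokesRegularity-13666) — cone repair (unit rrepair-NavierStokesRegularity-AffineB-83849e09): drop import Literature.Analysis.FluidPDE.AxisymmetricEuler — it is the ONLY path by which Li (planner-rrepair-NavierStokesRegularity-AffineB-83849e09-0)

sub-problem: NavierStokesRegularity · status: open · opened planner-plancard-NavierStokesRegularity-Navie-a0b3b573-0 2026-08-15T19:53:39Z · rev 1 · ledger route-NavierStokesRegularity-AffineBernoulli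
GENERATED by the gate from the ledger (D-0016/17). Provers cite these decls: `theorem foo : Summit.NavierStokesRegularity.NavierStokesRegularity.Theses.AffineBernoulli.<Decl> := …` in Summits/NavierStokesRegularity/NavierStokesRegularity/Theorems/<Name>.lean.
-/

namespace Summit.NavierStokesRegularity.NavierStokesRegularity.Theses.AffineBernoulli

open scoped BigOperators Topology Manifold Classical MeasureTheory ProbabilityTheory Matrix InnerProductSpace ComplexConjugate ContinuousMap
open Filter Set Function TopologicalSpace MeasureTheory

attribute [summit_statement] _root_.NavierStokesRegularity

open Literature.NS

/-- item stmt-NavierStokesRegularity-0056 · target · rank 0 · open · by planner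
why it might fail: a finite-energy Type-II singularity (= ¬Clay A): Tao's averaged blow-up is Type II (arXiv:1402.0290 p.8 fn.), Hou's axisymmetric scenario (arXiv:2107.06509) would be Type II if singular.
sources: Tao2016AveragedNS, Hou2022PotentiallySingularNS, KochNadirashviliSereginSverak2009, Seregin2024
If a finite-energy classical solution from a rapidly decaying datum has maximal lifespan T<∞ (no
classical extension past T), then ‖u(t)‖_∞ ≤ C (T−t)^{-1/2} eventually as t↑T (Leray's rate is the
matching lower bound, leray_blowup_rate_top). The hardest and most informative crux: a
counterexample is a Type II singularity, i.e. ¬(Clay A). Known: lower bound c√ν (T−t)^{-1/2} (Leray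
1934 §20); L³ must blow up (ESS 2003, Seregin 2012); only triple-log quantitative gain (Tao 2021). -/
@[route_item "route-NavierStokesRegularity-AffineBernoulli"]
def NoTypeII : Prop :=
  ∀ (ν T : ℝ), 0 < ν → 0 < T → ∀ (u : ℝ → EuclideanSpace ℝ (Fin 3) → EuclideanSpace ℝ (Fin 3)) (p : ℝ → EuclideanSpace ℝ (Fin 3) → ℝ), Literature.Analysis.FluidPDE.IsMaximalSmoothSolution ν 0 u p T → Literature.Analysis.FluidPDE.IsLerayHopfOn T ν 0 (u 0) u → Literature.Analysis.FluidPDE.HasRapidSpatialDecay (u 0) → Literature.Analysis.FluidPDE.IsTypeIBlowup u T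

/-- item stmt-NavierStokesRegularity-13660 · crux · rank 2 · open · by planner
why it might fail: the decay class is exactly critical (ChaeShvydkoy2013 need W∈L³ / Ω∈L^p, p<3/2), He builds such profiles on exterior domains, the far field σ(θ) is free data: a smooth completion across a saddle-type stagnation set may exist (it would be Hou's skeleton).
sources: ChaeShvydkoy2013, doi:10.1007/s00021-005-0205-3, ConstantinIgnatovaVicol2026Putative, Pomeau2017, arXiv:1901.09426, ArnoldKhesin1998
[crux] EULER–LERAY LIOUVILLE (card K2): if W ∈ C²(ℝ³;ℝ³) is divergence free, P ∈ C¹, ½W +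
DW(y)(½(y−c) + W(y)) + ∇P(y) = 0 for all y, and |W(y)| ≤ C⟨y⟩⁻¹, ‖DW(y)‖ ≤ C⟨y⟩⁻², then W ≡ 0.
Intended proof: Arnold-type classification of the affine-integrable structure (B)+(C) — vorticity
deserts on basins of sources (VorticityDesert), Poincaré–Hopf (index sum +1 forces a 2-stable saddle
or worse once sources are vorticity-free), Bernoulli surfaces pinned to critical values along
unstable manifolds, far-field matching ℋ = h_∞∘θ_∞, and the aligned stratum (AlignedStratumTrivial).
[difficulty: open-problem] -/
@[route_item "route-NavierStokesRegularity-AffineBernoulli", crux]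
def EulerLerayLiouville : Prop :=
  ∀ (c : EuclideanSpace ℝ (Fin 3)) (W : EuclideanSpace ℝ (Fin 3) → EuclideanSpace ℝ (Fin 3)) (P : EuclideanSpace ℝ (Fin 3) → ℝ), ContDiff ℝ 2 W → ContDiff ℝ 1 P → Literature.Analysis.FluidPDE.VectorCalculus.IsDivFree W → (∀ y, (1 / 2 : ℝ) • W y + fderiv ℝ W y ((1 / 2 : ℝ) • (y - c) + W y) + gradient P y = 0) → (∃ C : ℝ, ∀ y, ‖W y‖ ≤ C * (1 + ‖y‖)⁻¹ ∧ ‖fderiv ℝ W y‖ ≤ C * ((1 + ‖y‖) ^ 2)⁻¹) → ∀ y, W y = 0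

/-- item stmt-NavierStokesRegularity-13661 · crux · rank 3 · open · by planner
why it might fail: Type II need not be asymptotically self-similar: log-periodic (DSS) skeletons — Pomeau–Le Berre build τ-periodic Euler–Leray solutions formally (arXiv:1901.09426 §3) —, multiscale cascades, or mere C⁰ compactness of Seregin's Euler-scaling limits all escape both disjuncts.
sources: Seregin2024, arXiv:1901.09426, Hou2022PotentiallySingularNS, Hou2026, ConstantinIgnatovaVicol2026Putative, KochNadirashviliSereginSverak2009
[crux] CLOSED-WINDOW SKELETON (card K3, NS side): for ν, T > 0 and a maximal classical solution
(u,p) on [0,T) that is Leray–Hopf from a rapidly decaying datum and NOT Type I, EITHER the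
conclusion of VortexLineClock's TypeIIWindowCore holds verbatim (an exact window profile (γ,U,Ω),
2/5 ≤ γ < 1/2, with CIV matched decay, reached by a vorticity-normalised zoom at diverging local
Reynolds number in C¹_loc), OR there are a centre c, a profile W ∈ 𝓔½ (clauses of
EulerLerayLiouville) with ‖W(0)‖ ≥ 1/2, times t_k ↑ T, centres x_k, sup bounds N_k ≥ ‖u(t_k)‖_∞ with
N_k → ∞, lengths L_k → 0 with local Reynolds number N_k L_k/ν → ∞ and isometries Q_k such that y ↦
N_k⁻¹Q_k⁻¹u(t_k, x_k + L_k Q_k y) → W in C¹ on every ball. Heuristic: Type II ⇔ R(t) = (T−t)‖u‖²_∞/ν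
unbounded; a zoom at velocity scale N = g(T−t)^{-1/2} and Euler length L = N(T−t) sees viscosity
ν/g² → 0 and, modulo slowly varying factors, the γ = 1/2 similarity system; power-law excess g ~
(T−t)^{-δ} gives the window equation with γ = 1/2 − δ instead (finite energy: γ ≥ 2/5, CIV Thm 2.1).
Weaker than stmt-11272 (Sketch.lean `closedWindow_of_windowCore`). [difficulty: open-problem] -/
@[route_item "route-NavierStokesRegularity-AffineBernoulli", crux]
def ClosedWindowSkeleton : Prop :=
  ∀ (ν T : ℝ), 0 < ν → 0 < T → ∀ (u : ℝ → EuclideanSpace ℝ (Fin 3) → EuclideanSpace ℝ (Fin 3)) (p : ℝ → EuclideanSpace ℝ (Fin 3) → ℝ), Literature.Analysis.FluidPDE.IsMaximalSmoothSolution ν 0 u p T → Literature.Analysis.FluidPDE.IsLerayHopfOn T ν 0 (u 0) u → Literature.Analysis.FluidPDE.HasRapidSpatialDecay (u 0) → ¬ Literature.Analysis.FluidPDE.IsTypeIBlowup u T → (∃ (γ : ℝ) (U Ω : EuclideanSpace ℝ (Fin 3) → EuclideanSpace ℝ (Fin 3)), ((2 / 5 : ℝ) ≤ γ ∧ γ <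 1 / 2 ∧ ContDiff ℝ 2 U ∧ ContDiff ℝ 1 Ω ∧ Literature.Analysis.FluidPDE.VectorCalculus.IsDivFree U ∧ (∃ m : ℝ, 0 < m ∧ ∀ y, m • Ω y = Literature.Analysis.FluidPDE.curl U y) ∧ (∃ L : NNReal, LipschitzWith L U ∧ LipschitzWith L Ω) ∧ (∃ (c : EuclideanSpace ℝ (Fin 3)) (P : EuclideanSpace ℝ (Fin 3) → ℝ), ContDiff ℝ 1 P ∧ (∀ y, (1 - γ) • U y + fderiv ℝ U y (γ • (y - c) + U y) + gradient P y = 0) ∧ (∀ y, fderiv ℝ Ω y (γ • (y - c) + U y) - fderiv ℝ U y (Ω y) = -(Ω y))) ∧ (∃ C : ℝ, ∀ y, ‖Ω y‖ ≤ C * (1 + ‖y‖) ^ (-(1 / γ)) ∧ ‖U y‖ ≤ C * (1 + ‖y‖) ^ (1 - 1 / γ)) ∧ ‖Ω 0‖ = 1) ∧ ∃ (t : ℕ → ℝ) (x : ℕ → EuclideanSpace ℝ (Fin 3)) (A ℓ : ℕ → ℝ) (Q : ℕ → (EuclideanSpace ℝ (Fin 3) ≃ₗᵢ[ℝ] EuclideanSpace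 ℝ (Fin 3))), (∀ k, 0 ≤ t k ∧ t k < T) ∧ Filter.Tendsto t Filter.atTop (nhds T) ∧ (∀ k, 0 < A k ∧ 0 < ℓ k) ∧ Filter.Tendsto A Filter.atTop Filter.atTop ∧ Filter.Tendsto ℓ Filter.atTop (nhds 0) ∧ (∀ k, ‖Literature.Analysis.FluidPDE.curl (u (t k)) (x k)‖ = A k) ∧ (∀ k, (∀ z, dist z (x k) < ℓ k → A k / 2 < ‖Literature.Analysis.FluidPDE.curl (u (t k)) z‖) ∧ ∃ z, dist z (x k) = ℓ k ∧ ‖Literature.Analysis.FluidPDE.curl (u (t k)) z‖ ≤ A k / 2) ∧ Filter.Tendsto (fun k => A k * ℓ k ^ 2 / ν) Filter.atTop Filter.atTop ∧ ∀ R ε : ℝ, 0 < R → 0 < ε → ∃ k₀ : ℕ, ∀ k ≥ k₀, ∀ y : EuclideanSpace ℝ (Fin 3), ‖y‖ ≤ R → ‖(A k)⁻¹ • (Q k).symm (Literature.Analysis.FluidPDE.curl (u (t k)) (x k + ℓ k • Q k y)) - Ω y‖ + ‖fderiv ℝ (fun y' => (A k)⁻¹ • (Q k).symm (Literature.Analysis.FluidPDE.curl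 (u (t k)) (x k + ℓ k • Q k y'))) y - fderiv ℝ Ω y‖ ≤ ε) ∨ (∃ (c : EuclideanSpace ℝ (Fin 3)) (W : EuclideanSpace ℝ (Fin 3) → EuclideanSpace ℝ (Fin 3)) (P : EuclideanSpace ℝ (Fin 3) → ℝ), ContDiff ℝ 2 W ∧ ContDiff ℝ 1 P ∧ Literature.Analysis.FluidPDE.VectorCalculus.IsDivFree W ∧ (∀ y, (1 / 2 : ℝ) • W y + fderiv ℝ W y ((1 / 2 : ℝ) • (y - c) + W y) + gradient P y = 0) ∧ (∃ C : ℝ, ∀ y, ‖W y‖ ≤ C * (1 + ‖y‖)⁻¹ ∧ ‖fderiv ℝ W y‖ ≤ C * ((1 + ‖y‖) ^ 2)⁻¹) ∧ (1 / 2 : ℝ) ≤ ‖W 0‖ ∧ ∃ (t : ℕ → ℝ) (x : ℕ → EuclideanSpace ℝ (Fin 3)) (N L : ℕ → ℝ) (Q : ℕ → (EuclideanSpace ℝ (Fin 3) ≃ₗᵢ[ℝ] EuclideanSpace ℝ (Fin 3))), (∀ k, 0 ≤ t k ∧ t k < T) ∧ Filter.Tendsto t Filter.atTop (nhds T) ∧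 (∀ k, 0 < N k ∧ 0 < L k) ∧ Filter.Tendsto N Filter.atTop Filter.atTop ∧ Filter.Tendsto L Filter.atTop (nhds 0) ∧ (∀ k z, ‖u (t k) z‖ ≤ N k) ∧ Filter.Tendsto (fun k => N k * L k / ν) Filter.atTop Filter.atTop ∧ ∀ R ε : ℝ, 0 < R → 0 < ε → ∃ k₀ : ℕ, ∀ k ≥ k₀, ∀ y : EuclideanSpace ℝ (Fin 3), ‖y‖ ≤ R → ‖(N k)⁻¹ • (Q k).symm (u (t k) (x k + L k • Q k y)) - W y‖ + ‖fderiv ℝ (fun y' => (N k)⁻¹ • (Q k).symm (u (t k) (x k + L k • Q k y'))) y - fderiv ℝ W y‖ ≤ ε)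

-- earlier AxisymEulerLerayLiouville (stmt-NavierStokesRegularity-13662, replaced 2026-08-15T20:08:49Z -> stmt-NavierStokesRegularity-13904): retired by None — ∀ (W : EuclideanSpace ℝ (Fin 3) → EuclideanSpace ℝ (Fin 3)) (P : EuclideanSpace ℝ (Fin 3) → ℝ), Literature.Analysis.FluidPDE.IsAxisymmetric W → ContDiff ℝ 2 W → ContDiff ℝ 1 P → Literature.Analysis.FluidPDE.VectorCalculus.IsDivFree W → (∀ y, (
/-- item stmt-NavierStokesRegularity-13904 · crux · rank 4 · open · by planner
why it might fail: Hou's axisymmetric interior blow-up (arXiv:2107.06509 §3.4) is nearly self-similar with ‖u‖∞ ~ (T−t)^{-1/2}: its limiting profile, if steady, is a nontrivial axisymmetric member of 𝓔½ with swirl datum g_∞ ≢ 0, refuting the crux.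
sources: arXiv:1901.09426, Hou2022PotentiallySingularNS, Hou2026, ConstantinIgnatovaVicol2026Putative, ChaeShvydkoy2013
[crux] AXISYMMETRIC EULER–LERAY LIOUVILLE, swirl allowed (card K2, first case; centre on the axis,
translated to 0): an axisymmetric W ∈ 𝓔½ (clauses of EulerLerayLiouville with c = 0) vanishes
identically. Axisymmetry is written out as rotation-equivariance W (R_θ x) = R_θ (W x) about the
x₂-axis with R_θ inlined — verbatim `Literature.Analysis.FluidPDE.IsAxisymmetric W` (Iff.rfl; cone
repair 2026-08-15: the route file must not import AxisymmetricEuler, which drags in Vorticity.lean's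
refuted fact IsVorticitySolutionOn.exists_pressure; a prover imports
Literature.Analysis.FluidPDE.AxisymmetricEuler in the Theorems file and converts by Iff.rfl /
`show`). Beyond Pomeau–Le Berre (§2.3: the swirl G = ρW_φ is a first integral of V, so G ≡ 0 IF G →
0 at infinity — support AxisymDecayingSwirlLiouville) the content is the BOUNDED swirl datum g_∞(θ)
= lim ρW_φ along rays: G = g_∞∘θ_∞ on the basin of infinity, the meridional similarity flow has its
zeros on the axis or on circles, and Z = Ω_φ/ρ obeys V·∇Z + (3/2)Z = ∂_z(G²)/ρ⁴; show g_∞ ≢ 0 is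
incompatible with smoothness at the stagnation set (refuter audit rev 0: the whole difficulty is
stagnation CIRCLES off the axis carrying g_∞ ≢ 0, i.e -/
@[route_item "route-NavierStokesRegularity-AffineBernoulli"]
def AxisymEulerLerayLiouville : Prop :=
  ∀ (W : EuclideanSpace ℝ (Fin 3) → EuclideanSpace ℝ (Fin 3)) (P : EuclideanSpace ℝ (Fin 3) → ℝ), (∀ (θ : ℝ) (x : EuclideanSpace ℝ (Fin 3)), W (WithLp.toLp 2 ![Real.cos θ * x 0 - Real.sin θ * x 1, Real.sin θ * x 0 + Real.cos θ * x 1, x 2]) = WithLp.toLp 2 ![Real.cos θ * W x 0 - Real.sin θ * W x 1, Real.sin θ * W x 0 + Real.cos θ * W x 1, W x 2]) → ContDiff ℝ 2 W → ContDiff ℝ 1 P → Literature.Analysis.FluidPDE.VectorCalculus.IsDivFree W → (∀ y, (1 / 2 : ℝ) • W y + fderiv ℝ W y ((1 / 2 : ℝ) • y + W y) + gradient P y = 0) → (∃ C : ℝ, ∀ y, ‖W y‖ ≤ C * (1 + ‖y‖)⁻¹ ∧ ‖fderiv ℝ W y‖ ≤ C * ((1 + ‖y‖) ^ 2)⁻¹)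 → ∀ y, W y = 0

/-- item stmt-NavierStokesRegularity-13663 · crux · rank 5 · closed · proved by Summit.NavierStokesRegularity.NavierStokesRegularity.Theorems.affineBernoulli_alignedStratumTrivial_proof (prover) · by planner
why it might fail: a 'similarity-Beltrami' field curl W = λ(½(y−c)+W) with |W| ~ 1/|y| hanging off a saddle with an unstable eigenvalue > 3/2 is not excluded by any known argument; Beltrami fields are exactly where Arnold's structure theorem is silent.
sources: ArnoldKhesin1998, ConstantinIgnatovaVicol2026Putative, Chae2007CMPEuler
[crux] ALIGNED (BELTRAMI-LIKE) STRATUM IS TRIVIAL (card K1, the degenerate case of the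
Bernoulli-surface structure theorem): if W ∈ 𝓔½ (clauses of EulerLerayLiouville) has Ω × V ≡ 0, i.e.
curl W ∥ ½(y−c) + W everywhere (equivalently ℋ locally constant — no Bernoulli foliation), then W ≡
0. At γ = 1/2 this ansatz is kinematically self-consistent (Ω = λV with V·∇λ = −(3/2)λ solves div Ω
= 0 precisely because div V = 3/2), so it is a genuine stratum, not a formality; λ is transported
with weight −3/2, forcing backward V-trajectories of aligned points to reach Zeros(V) at exponential
rate ≥ 3/2. [difficulty: M] -/
@[route_item "route-NavierStokesRegularity-AffineBernoulli"]
def AlignedStratumTrivial : Prop :=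
  ∀ (c : EuclideanSpace ℝ (Fin 3)) (W : EuclideanSpace ℝ (Fin 3) → EuclideanSpace ℝ (Fin 3)) (P : EuclideanSpace ℝ (Fin 3) → ℝ), ContDiff ℝ 2 W → ContDiff ℝ 1 P → Literature.Analysis.FluidPDE.VectorCalculus.IsDivFree W → (∀ y, (1 / 2 : ℝ) • W y + fderiv ℝ W y ((1 / 2 : ℝ) • (y - c) + W y) + gradient P y = 0) → (∃ C : ℝ, ∀ y, ‖W y‖ ≤ C * (1 + ‖y‖)⁻¹ ∧ ‖fderiv ℝ W y‖ ≤ C * ((1 + ‖y‖) ^ 2)⁻¹) → (∀ y, Literature.Analysis.FluidPDE.cross (Literature.Analysis.FluidPDE.curl W y) ((1 / 2 : ℝ) • (y - c) + W y) = 0) → ∀ y, W y = 0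

-- `AlignedStratumTrivial` holds: proved by `Summit.NavierStokesRegularity.NavierStokesRegularity.Theorems.affineBernoulli_alignedStratumTrivial_proof` (its module imports this route file, so no `_holds` link can be stated here).

/-- item stmt-NavierStokesRegularity-0055 · support · rank 9 · closed · proved by Summit.NavierStokesRegularity.NavierStokesRegularity.Theorems.typeICertificateLadder_noBlowupToClay_proof @ 8d57e70af7e2 (prover) · by planner
sources: Leray1934, KochNadirashviliSereginSverak2009, Fefferman2000
Given NoBlowup, build the Clay (A) solution: local finite-energy classical solution for smooth
divergence-free rapidly decaying data (Leray 1934 §III / Fujita–Kato 1964 + LPS smoothing), continue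
past every T using NoBlowup, glue by weak–strong uniqueness (Prodi–Serrin), bounded energy from the
energy inequality, and convert with
Literature.Analysis.FluidPDE.isNavierStokesSolution_and_smooth_iff. Blow-up at spatial infinity is
excluded by CKN ε-regularity applied far out. May take named Literature facts (leray_existence_R3,
ladyzhenskaya_prodi_serrin, weak_strong_uniqueness, fujita_kato_local) as hypotheses if the grounder
so rules. -/
@[route_item "route-NavierStokesRegularity-AffineBernoulli", crux]
def NoBlowupToClay : Prop :=
  (∀ (ν T : ℝ), 0 < ν → 0 < T → ∀ (u : ℝ → EuclideanSpace ℝ (Fin 3) → EuclideanSpace ℝ (Fin 3)) (p : ℝ → EuclideanSpace ℝ (Fin 3) → ℝ), Literature.Analysis.FluidPDE.IsClassicalNSSolutionOn (Set.Ico 0 T) ν 0 u p → Literature.Analysis.FluidPDE.IsLerayHopfOn T ν 0 (u 0) u → Literature.Analysis.FluidPDE.HasRapidSpatialDecay (u 0) → Literature.Analysis.FluidPDE.HasSmoothExtensionPast ν 0 u T) → NavierStokesRegularity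

/-- `NoBlowupToClay` holds: proved by `Summit.NavierStokesRegularity.NavierStokesRegularity.Theorems.typeICertificateLadder_noBlowupToClay_proof` @ 8d57e70af7e2. -/
theorem NoBlowupToClay_holds : NoBlowupToClay := _root_.Summit.NavierStokesRegularity.NavierStokesRegularity.Theorems.typeICertificateLadder_noBlowupToClay_proof

/-- item stmt-NavierStokesRegularity-11273 · support · rank 9 · open · by planner
sources: ConstantinIgnatovaVicol2026Putative, arXiv:2602.17570, arXiv:2511.16254, ChaeShvydkoy2013
[crux] THE EULER WINDOW IS EMPTY: there is no (γ, U, Ω) satisfying the window-profile clauses of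
TypeIIWindowCore — no exact self-similar Euler blow-up profile with 2/5 ≤ γ < 1/2, Lipschitz
normalised vorticity and CIV matched decay. Known: γ ≥ 2/5 is forced by finite energy (CIV Thm 2.1);
under the local OUTGOING property γ ≥ 1/2 (CIV Thms 3.8, 3.10), axisymmetric cases (CIV Thms 4.4,
4.6); open: profiles whose self-similar Lagrangian field V = γ(y−c)+U has non-outgoing stagnation
points or an infinite nodal set. Intended proof = WindowGlue: FluxCapacityRecurrence →
SeifertResidual → ProfileClockNoCycle. [difficulty: open-problem] -/
@[route_item "route-NavierStokesRegularity-AffineBernoulli", crux]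
def EmptyEulerWindow : Prop :=
  ∀ (γ : ℝ) (U Ω : EuclideanSpace ℝ (Fin 3) → EuclideanSpace ℝ (Fin 3)), ¬ ((2 / 5 : ℝ) ≤ γ ∧ γ < 1 / 2 ∧ ContDiff ℝ 2 U ∧ ContDiff ℝ 1 Ω ∧ Literature.Analysis.FluidPDE.VectorCalculus.IsDivFree U ∧ (∃ m : ℝ, 0 < m ∧ ∀ y, m • Ω y = Literature.Analysis.FluidPDE.curl U y) ∧ (∃ L : NNReal, LipschitzWith L U ∧ LipschitzWith L Ω) ∧ (∃ (c : EuclideanSpace ℝ (Fin 3)) (P : EuclideanSpace ℝ (Fin 3) → ℝ), ContDiff ℝ 1 P ∧ (∀ y, (1 - γ) • U y + fderiv ℝ U y (γ • (y - c) + U y) + gradient P y = 0) ∧ (∀ y, fderiv ℝ Ω y (γ • (y - c) + U y) - fderiv ℝ U y (Ω y) = -(Ω y))) ∧ (∃ C : ℝ, ∀ y, ‖Ω y‖ ≤ C * (1 + ‖y‖) ^ (-(1 / γ)) ∧ ‖U y‖ ≤ C * (1 + ‖y‖) ^ (1 - 1 / γ)) ∧ ‖Ω 0‖ = 1)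

/-- item stmt-NavierStokesRegularity-1217 · support · rank 9 · open · by planner
sources: KochNadirashviliSereginSverak2009, AlbrittonBarker2019, SereginSverak2009
[target] X = NO TYPE-I BLOW-UP FOR CLAY DATA: a classical solution of unforced NS on ℝ³×[0,T) which
is Leray–Hopf from a rapidly decaying datum and blows up at most at the Type-I rate ‖u(t)‖∞ ≤
C(T−t)^{-1/2} extends smoothly past T. Equals UnthreadedNoBlowup ∧ ThreadedNoBlowup by excluded
middle on 'every point is unthreaded' (proved in the planner's Sketch.lean: target_of_cruxes); it is
the unconditional conclusion of stmt-NavierStokesRegularity-0058 (route TypeILiouville, which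
assumes (L)). With NoTypeII (stmt-0056) it gives NoBlowup (stmt-0054). Card:
threading-flux-trace-topology. -/
@[route_item "route-NavierStokesRegularity-AffineBernoulli", crux]
def NoTypeIBlowup : Prop :=
  ∀ (ν T : ℝ), 0 < ν → 0 < T → ∀ (u : ℝ → EuclideanSpace ℝ (Fin 3) → EuclideanSpace ℝ (Fin 3)) (p : ℝ → EuclideanSpace ℝ (Fin 3) → ℝ), Literature.Analysis.FluidPDE.IsClassicalNSSolutionOn (Set.Ico 0 T) ν 0 u p → Literature.Analysis.FluidPDE.IsLerayHopfOn T ν 0 (u 0) u → Literature.Analysis.FluidPDE.HasRapidSpatialDecay (u 0) → Literature.Analysis.FluidPDE.IsTypeIBlowup u T → Literature.Analysis.FluidPDE.HasSmoothExtensionPast ν 0 u T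

/-- item stmt-NavierStokesRegularity-13664 · support · rank 9 · closed · proved by Summit.NavierStokesRegularity.NavierStokesRegularity.Theorems.affineBernoulli_affineBernoulliIdentities_proof (prover) · by planner
sources: ConstantinIgnatovaVicol2026Putative, arXiv:2602.17570, MajdaBertozzi2002
[support] card P1 (provable now, two pages of calculus): for C² divergence-free W and C¹ P solving
the γ = 1/2 profile equation with centre c (no decay needed), with V = ½(y−c) + W, Ω = curl W, ℋ(z)
= ½‖½(z−c) + W(z)‖² + P(z) − ⅛‖z−c‖²: (B) ∇ℋ = −Ω × V (so V·∇ℋ = Ω·∇ℋ = 0) and (C) DΩ·V − DW·Ω = −Ω,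
i.e. [V,Ω] = −(3/2)Ω (= CIV (3.x) at γ = 1/2; the vorticity form used verbatim by VortexLineClock).
[difficulty: provable-now] -/
@[route_item "route-NavierStokesRegularity-AffineBernoulli"]
def AffineBernoulliIdentities : Prop :=
  ∀ (c : EuclideanSpace ℝ (Fin 3)) (W : EuclideanSpace ℝ (Fin 3) → EuclideanSpace ℝ (Fin 3)) (P : EuclideanSpace ℝ (Fin 3) → ℝ), ContDiff ℝ 2 W → ContDiff ℝ 1 P → Literature.Analysis.FluidPDE.VectorCalculus.IsDivFree W → (∀ y, (1 / 2 : ℝ) • W y + fderiv ℝ W y ((1 / 2 : ℝ) • (y - c) + W y) + gradient P y = 0) → ∀ y, gradient (fun z => (1 / 2 : ℝ) * ‖(1 / 2 : ℝ) • (z - c) + W z‖ ^ 2 + P z - (1 / 8 : ℝ) * ‖z - c‖ ^ 2) y = -(Literature.Analysis.FluidPDE.cross (Literature.Analysis.FluidPDE.curl W y) ((1 / 2 : ℝ) • (y - c) + W y)) ∧ fderiv ℝ (Literature.Analysis.FluidPDE.curl W) y ((1 / 2 : ℝ) • (y - c) + W y) - fderiv ℝ W y (Literature.Analysis.FluidPDE.curl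 W y) = -(Literature.Analysis.FluidPDE.curl W y)

-- `AffineBernoulliIdentities` holds: proved by `Summit.NavierStokesRegularity.NavierStokesRegularity.Theorems.affineBernoulli_affineBernoulliIdentities_proof` (its module imports this route file, so no `_holds` link can be stated here).

/-- item stmt-NavierStokesRegularity-13665 · support · rank 9 · closed · proved by Summit.NavierStokesRegularity.NavierStokesRegularity.Theorems.affineBernoulli_vorticityDesert_proof (prover) · by planner
sources: ConstantinIgnatovaVicol2026Putative, arXiv:2602.17570
[support] SOURCE LEMMA (card P1, local form; provable now): if V, Ω are C¹ on ℝ³, V(y₀) = 0, the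
symmetric part of DV(y₀) is pinched a‖v‖² ≤ ⟨DV(y₀)v, v⟩ ≤ b‖v‖² with 0 < a and b < 3/2, and DΩ·V −
DV·Ω = −(3/2)Ω everywhere, then Ω vanishes on a neighbourhood of y₀. Proof: f = ‖Ω‖² satisfies V·∇f
= 2⟨DV Ω,Ω⟩ − 3f ≤ −(3 − 2b − o(1)) f near y₀ while backward V-trajectories from a small ball stay
in it and converge to y₀; f bounded there forces f = 0. (CIV Prop. 3.9 is the γ < 1/2 + c* analogue
at outgoing points.) [difficulty: provable-now] -/
@[route_item "route-NavierStokesRegularity-AffineBernoulli"]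
def VorticityDesert : Prop :=
  ∀ (V Ω : EuclideanSpace ℝ (Fin 3) → EuclideanSpace ℝ (Fin 3)) (y₀ : EuclideanSpace ℝ (Fin 3)), ContDiff ℝ 1 V → ContDiff ℝ 1 Ω → V y₀ = 0 → (∃ a b : ℝ, 0 < a ∧ b < 3 / 2 ∧ ∀ v : EuclideanSpace ℝ (Fin 3), a * ‖v‖ ^ 2 ≤ ⟪fderiv ℝ V y₀ v, v⟫_ℝ ∧ ⟪fderiv ℝ V y₀ v, v⟫_ℝ ≤ b * ‖v‖ ^ 2) → (∀ y, fderiv ℝ Ω y (V y) - fderiv ℝ V y (Ω y) = -((3 / 2 : ℝ) • Ω y)) → ∃ ε : ℝ, 0 < ε ∧ ∀ y, dist y y₀ < ε → Ω y = 0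

-- `VorticityDesert` holds: proved by `Summit.NavierStokesRegularity.NavierStokesRegularity.Theorems.affineBernoulli_vorticityDesert_proof` (its module imports this route file, so no `_holds` link can be stated here).

-- earlier AxisymDecayingSwirlLiouville (stmt-NavierStokesRegularity-13666, replaced 2026-08-15T20:08:49Z -> stmt-NavierStokesRegularity-13905): retired by None — ∀ (W : EuclideanSpace ℝ (Fin 3) → EuclideanSpace ℝ (Fin 3)) (P : EuclideanSpace ℝ (Fin 3) → ℝ), Literature.Analysis.FluidPDE.IsAxisymmetric W → ContDiff ℝ 2 W → ContDiff ℝ 1 P → Literature.Analysis.FluidPDE.VectorCalculus.IsDivFree W → (∀ y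
/-- item stmt-NavierStokesRegularity-13905 · support · rank 9 · closed · proved by Summit.NavierStokesRegularity.NavierStokesRegularity.Theorems.affineBernoulli_axisymDecayingSwirlLiouville_proof (prover) · by planner
sources: arXiv:1901.09426, Pomeau2017, ChaeShvydkoy2013
[support] POMEAU–LE BERRE CASE made a theorem (needs ODE-flow infrastructure): an axisymmetric W ∈
𝓔½ (c = 0) whose swirl G = ρW_φ = x₀W₁ − x₁W₀ tends to 0 at infinity vanishes identically. Swirl and
axisymmetry are written out — verbatim `Literature.Analysis.FluidPDE.swirl W` (rfl) and
`IsAxisymmetric W` (Iff.rfl), inlined by the cone repair 2026-08-15 so the route does not import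
AxisymmetricEuler/Vorticity; provers import AxisymmetricEuler in Theorems and convert
definitionally. Proof: G is a first integral of the complete field V = ½y + W (arXiv:1901.09426 eq.
after (2.3)); the bounded invariant set Inv(V) is Lebesgue-null since the flow multiplies volume by
e^{3σ/2}, so G ≡ 0 on the dense basin of infinity; with no swirl Z = Ω_φ/ρ satisfies V·∇Z = −(3/2)Z,
backward trajectories are bounded (V·y ≥ ½|y|² − C), hence Z ≡ 0, Ω ≡ 0, and a curl- and
divergence-free field decaying at infinity is 0. [difficulty: L] -/
@[route_item "route-NavierStokesRegularity-AffineBernoulli"]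
def AxisymDecayingSwirlLiouville : Prop :=
  ∀ (W : EuclideanSpace ℝ (Fin 3) → EuclideanSpace ℝ (Fin 3)) (P : EuclideanSpace ℝ (Fin 3) → ℝ), (∀ (θ : ℝ) (x : EuclideanSpace ℝ (Fin 3)), W (WithLp.toLp 2 ![Real.cos θ * x 0 - Real.sin θ * x 1, Real.sin θ * x 0 + Real.cos θ * x 1, x 2]) = WithLp.toLp 2 ![Real.cos θ * W x 0 - Real.sin θ * W x 1, Real.sin θ * W x 0 + Real.cos θ * W x 1, W x 2]) → ContDiff ℝ 2 W → ContDiff ℝ 1 P → Literature.Analysis.FluidPDE.VectorCalculus.IsDivFree W → (∀ y, (1 / 2 : ℝ) • W y + fderiv ℝ W y ((1 / 2 : ℝ) • y + W y) + gradient P y = 0) → (∃ C : ℝ, ∀ y, ‖W y‖ ≤ C * (1 + ‖y‖)⁻¹ ∧ ‖fderiv ℝ W y‖ ≤ C * ((1 + ‖y‖) ^ 2)⁻¹) → Filter.Tendsto (fun x : EuclideanSpace ℝ (Fin 3) => x 0 * W x 1 - x 1 * W x 0) (Filter.cocompact (EuclideanSpace ℝ (Fin 3))) (nhds 0) → ∀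 y, W y = 0

-- `AxisymDecayingSwirlLiouville` holds: proved by `Summit.NavierStokesRegularity.NavierStokesRegularity.Theorems.affineBernoulli_axisymDecayingSwirlLiouville_proof` (its module imports this route file, so no `_holds` link can be stated here).

/-- item stmt-NavierStokesRegularity-13667 · assembly · rank 1 · closed · proved by Summit.NavierStokesRegularity.NavierStokesRegularity.Theorems.affineBernoulli_assembly_proof (prover) · by planner
sources: KochNadirashviliSereginSverak2009, ConstantinIgnatovaVicol2026Putative
[assembly] ClosedWindowSkeleton → EmptyEulerWindow → EulerLerayLiouville → NoTypeIBlowup →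
NoBlowupToClay → NavierStokesRegularity (theorem assembly_holds := closes in Sketch.lean). -/
@[route_item "route-NavierStokesRegularity-AffineBernoulli"]
def Assembly : Prop :=
  ClosedWindowSkeleton → EmptyEulerWindow → EulerLerayLiouville → NoTypeIBlowup → NoBlowupToClay → NavierStokesRegularity

-- `Assembly` holds: proved by `Summit.NavierStokesRegularity.NavierStokesRegularity.Theorems.affineBernoulli_assembly_proof` (its module imports this route file, so no `_holds` link can be stated here).

/-! D-0027 §2.1 — DECIDING THEOREM (planner-authored via `route open/edit --closes-file`; by planner-plancard-NavierStokesRegularity-Navie-a0b3b573-0 2026-08-15T19:53:39Z):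
its hypotheses are this route's items and its conclusion the sub-problem Statement (glue_lint), and it elaborates with this file. -/

@[closes "route-NavierStokesRegularity-AffineBernoulli"] theorem closes (h₁ : ClosedWindowSkeleton) (h₂ : EmptyEulerWindow) (h₃ : EulerLerayLiouville) (h₄ : NoTypeIBlowup) (h₅ : NoBlowupToClay) : NavierStokesRegularity := by
  apply h₅
  intro ν T hν hT u p hcl hLH hdec
  by_contra hext
  have hmax : Literature.Analysis.FluidPDE.IsMaximalSmoothSolution ν 0 u p T := ⟨hcl, hext⟩
  by_cases hI : Literature.Analysis.FluidPDE.IsTypeIBlowup u T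
  · exact hext (h₄ ν T hν hT u p hcl hLH hdec hI)
  · rcases h₁ ν T hν hT u p hmax hLH hdec hI with ⟨γ, U, Ω, hW, -⟩ | ⟨c, W, P, hC2, hC1, hdiv, heq, hdecay, hW0, -⟩
    · exact h₂ γ U Ω hW
    · have h0 := h₃ c W P hC2 hC1 hdiv heq hdecay 0
      rw [h0, norm_zero] at hW0
      norm_num at hW0

end Summit.NavierStokesRegularity.NavierStokesRegularity.Theses.AffineBernoulli
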